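import Literature.MathematicalPhysics.QuantumFieldTheory.Balaban1983to89.B16Ineq175Tilted
import Summits.QuantumFields.BalabanUV.T4Continuum.Spine.NE1p.DressedMGFForm
import Summits.QuantumFields.YangMills.Theorems.BalabanUVNodesN14DressedWeightSlice
import Mathlib.Analysis.Complex.CauchyIntegral
import Mathlib.Analysis.Complex.Liouville

/-!
# Node N14 = NE1′ — BY-IMPORT COROLLARIES: the tilted operation is ANALYTIC in the source (from dag-n14-b's p409237), row NE1′'s
# two typed currencies meet (consumer's real tilted mean = (1.75)ₜ at ρ₀ ≡ 1, σ ≡ 0), and the dressed weight slice fires on the decided toy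

Cell `pub-ymgap`, HUMAN RULING D-0062, seat `pub-ymgap-dag-n14-a` (-a KNIT-BY-NAME of N14); venue `Summits/QuantumFields/YangMills/Theorems/`
(R424), namespace `YMDAG.N14`; THEOREMS ONLY; per dag-lead's DEDUP word (pub-ymgap INBOX l.9048 (2)): «any statement p409237 lacks goes into
a short module IMPORTING p409237 after it lands (by-name corollaries, no restated bodies)».  The one such statement: complex-differentiable
on an OPEN set ⇒ ANALYTIC there (Mathlib `DifferentiableOn.analyticOnNhd`, complete target) — the «t-analytic dressed normalised
operation» of NE1′ at the level of ONE complex-weight integral, on the open tilt disc `{t | s + ‖t‖·B < 1}`.  PLUS the bridge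
between row NE1′'s two typed currencies: `tiltedMean_consumer_eq` — the consumer's REAL tilted mean `NE1p.DressedMGFForm.tiltedMean F ν s`
(the currency of the residual binder `TiltedMeanMatching`, Mathlib `Measure.tilted`) IS the (1.75)ₜ operation at `(ρ₀, σ, W, h, t) =
(1, 0, F, F, s)` read in `ℂ` (imports the consumer module `Spine/NE1p/DressedMGFForm`, p341456, by name).  PLUS non-vacuity of this
seat's slice module `BalabanUVNodesN14DressedWeightSlice`: `toyObservable_alongSlices` ∕ `weightSlice_dressed_toy` ∕ `opSliceOn_dressed_toy` —
`weightSlice_dressed` and `opSliceOn_wOp_dressed` FIRE on the lineage's decided toy `T4TrajectoryDensity.weightSlice_linExp` dressed by `e^{τU}`.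
PLUS THE DRESSED TRANSPORT LEAF BY NAME: `transportsFromVar_dressed_of_weightSlices_lattice` — END-F's `ℤ^d` weight-slice pipeline
`T4TrajectoryDensity.transportsFromVar_of_weightSlices_lattice` for the step operation `wOp (ω_k·e^{τG_k}) …` of the DRESSED run, the
weight-slice binder supplied by the UNDRESSED slices + the observable's slices (`weightSlice_dressed`), margin `s k + l₀·Bo k ≤ 1`,
domination `e^{3(s k + l₀ Bo k)}`: conclusion `T.TransportsFromVar (4c_δ∕r) (ψ·α) Gate` = the field `htr` of `DressedRoot.BookingLeaves`
for the dressed trajectory — the T-leaf of N14's slot «uniform leaves» under the reading «dressing in the weight».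

HONEST FRAMING.  [folklore] one-variable complex analysis on abstract data; NOT PRINTED ([Balaban1989LargeFieldII] p. 356 ll. 1–6 defers
observables; (1.73)–(1.75) p. 380 are the undressed kernels); nothing of Bałaban's asserted; NOT a discharge of N14 (OBJECT-bound);
count-neutral; one finite T⁴ at fixed ε — NOT ℝ⁴, NOT OS, NOT a mass gap, NOT Clay.
-/

namespace YMDAG.N14

open MeasureTheory Set Metric Filter
open Literature.MathematicalPhysics.QuantumFieldTheory.Balaban1983to89.B16Ineq175Tilted
open Literature.MathematicalPhysics.QuantumFieldTheory.Balaban1983to89.T4TrajectoryDensity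
open Literature.MathematicalPhysics.QuantumFieldTheory.Balaban1983to89.T4TrajectoryModulus (OpSliceOn)

noncomputable section

variable {Z : Type*} [MeasurableSpace Z] {μ : Measure Z} {F : Type*} [NormedAddCommGroup F] [NormedSpace ℂ F]
variable {ρ₀ : Z → ℝ} {σ W : Z → ℂ} {h : Z → F} {s B m : ℝ}

/-- The open tilt disc `{t | s + ‖t‖·B < 1}` is open. [folklore] -/
theorem isOpen_tiltDisc (s B : ℝ) : IsOpen {t : ℂ | s + ‖t‖ * B < 1} :=
  isOpen_lt (continuous_const.add (continuous_norm.mul continuous_const)) continuous_const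

/-- The disc contains the closed source ball `‖t‖ ≤ l₀` whenever `s + l₀·B < 1` and `0 ≤ B` (non-vacuity of the disc hypothesis for a
source window). [folklore] -/
theorem mem_tiltDisc_of_norm_le {l₀ : ℝ} (hB : 0 ≤ B) (hl : s + l₀ * B < 1) {t : ℂ} (ht : ‖t‖ ≤ l₀) :
    t ∈ {t : ℂ | s + ‖t‖ * B < 1} := by
  show s + ‖t‖ * B < 1
  have := mul_le_mul_of_nonneg_right ht hB
  linarith

/-- **THE TILTED NORMALISED OPERATION IS ANALYTIC IN THE SOURCE** on the open tilt disc `{t | s + ‖t‖·B < 1}` [folklore]: p409237's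
`differentiableOn_tiltedMean` (complex-differentiable there) + Mathlib `DifferentiableOn.analyticOnNhd` (open set, complete target). -/
theorem analyticOnNhd_tiltedMean [CompleteSpace F] (hρ : Integrable ρ₀ μ) (hρ0 : 0 ≤ᵐ[μ] ρ₀) (hP : 0 < ∫ z, ρ₀ z ∂μ)
    (hσm : AEStronglyMeasurable σ μ) (hWm : AEStronglyMeasurable W μ) (hσ : ∀ᵐ z ∂μ, ‖σ z‖ ≤ s)
    (hW : ∀ᵐ z ∂μ, ‖W z‖ ≤ B) (hhm : AEStronglyMeasurable h μ) (hh : ∀ᵐ z ∂μ, ‖h z‖ ≤ m) :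
    AnalyticOnNhd ℂ (fun τ : ℂ => tiltedMean μ ρ₀ σ W h τ) {t : ℂ | s + ‖t‖ * B < 1} :=
  (differentiableOn_tiltedMean hρ hρ0 hP hσm hWm hσ hW hhm hh).analyticOnNhd (isOpen_tiltDisc s B)

/-- … in particular ANALYTIC AT every source of the window `‖t‖ ≤ l₀` when `s + l₀·B < 1`, `0 ≤ B`. [folklore] -/
theorem analyticAt_tiltedMean [CompleteSpace F] (hρ : Integrable ρ₀ μ) (hρ0 : 0 ≤ᵐ[μ] ρ₀) (hP : 0 < ∫ z, ρ₀ z ∂μ)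
    (hσm : AEStronglyMeasurable σ μ) (hWm : AEStronglyMeasurable W μ) (hσ : ∀ᵐ z ∂μ, ‖σ z‖ ≤ s)
    (hW : ∀ᵐ z ∂μ, ‖W z‖ ≤ B) (hhm : AEStronglyMeasurable h μ) (hh : ∀ᵐ z ∂μ, ‖h z‖ ≤ m)
    {l₀ : ℝ} (hB : 0 ≤ B) (hl : s + l₀ * B < 1) {t : ℂ} (ht : ‖t‖ ≤ l₀) :
    AnalyticAt ℂ (fun τ : ℂ => tiltedMean μ ρ₀ σ W h τ) t :=
  analyticOnNhd_tiltedMean hρ hρ0 hP hσm hWm hσ hW hhm hh t (mem_tiltDisc_of_norm_le hB hl ht)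

/-! ## The two typed currencies of row NE1′ meet: the consumer's REAL tilted mean IS the tilted normalised operation at `(ρ₀, σ) = (1, 0)` -/

section Currencies

variable {Ω : Type*} [MeasurableSpace Ω]

/-- **ONE OBJECT, TWO CURRENCIES** [bookkeeping]: for a real observable `F` and a real tilt `s`, the consumer row's tilted mean
`NE1p.DressedMGFForm.tiltedMean F ν s = ∫ F d(ν.tilted (s·F))` (the residual binder `TiltedMeanMatching`'s currency, Mathlib
`Measure.tilted`) IS, read in `ℂ`, the tilted normalised complex-weight operation of (1.75)ₜ (`B16Ineq175Tilted.tiltedMean`, dag-n14-b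
p409237) at density `ρ₀ ≡ 1`, exponent `σ ≡ 0`, observable `W = F`, integrand `h = F`, source `t = s`:
`(∫e^{sF}dν)⁻¹ • ∫e^{sF}•F dν`.  So the -b walk's currencies (i) ((1.71)–(1.75)) and (ii) (`TiltedMeanMatching`) speak about the same
number on the real source axis (Mathlib `integral_tilted`, `integral_ofReal`). [folklore] -/
theorem tiltedMean_consumer_eq (ν : Measure Ω) (F : Ω → ℝ) (s : ℝ) :
    ((Summit.QuantumFields.BalabanUV.T4Continuum.NE1p.DressedMGFForm.tiltedMean F ν s : ℝ) : ℂ) =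
      tiltedMean ν (fun _ => (1 : ℝ)) (fun _ => (0 : ℂ)) (fun ω => (F ω : ℂ)) (fun ω => (F ω : ℂ)) (s : ℂ) := by
  -- the consumer side: `∫ F d(ν.tilted (sF)) = (∫ e^{sF} F dν) / ∫ e^{sF} dν`
  have hR : Summit.QuantumFields.BalabanUV.T4Continuum.NE1p.DressedMGFForm.tiltedMean F ν s =
      (∫ ω, Real.exp (s * F ω) * F ω ∂ν) / ∫ ω, Real.exp (s * F ω) ∂ν := by
    show ∫ ω, F ω ∂(ν.tilted fun ω => s * F ω) = _
    rw [integral_tilted]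
    have e : (fun ω => (Real.exp (s * F ω) / ∫ x, Real.exp (s * F x) ∂ν) • F ω) =
        fun ω => (Real.exp (s * F ω) * F ω) / ∫ x, Real.exp (s * F x) ∂ν := by
      funext ω; rw [smul_eq_mul]; ring
    rw [e, integral_div]
  -- the (1.75)ₜ side: both complex integrands are `ofReal` of the real ones
  have hw : ∀ ω, tiltWeight (fun _ => (1 : ℝ)) (fun _ => (0 : ℂ)) (fun ω => (F ω : ℂ)) (s : ℂ) ω =
      ((Real.exp (s * F ω) : ℝ) : ℂ) := fun ω => by
    rw [tiltWeight_apply, zero_add, Complex.ofReal_one, one_mul, Complex.ofReal_exp, Complex.ofReal_mul]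
  have hD : ∫ ω, tiltWeight (fun _ => (1 : ℝ)) (fun _ => (0 : ℂ)) (fun ω => (F ω : ℂ)) (s : ℂ) ω ∂ν =
      ((∫ ω, Real.exp (s * F ω) ∂ν : ℝ) : ℂ) := by
    rw [← integral_complex_ofReal]
    exact integral_congr_ae (Eventually.of_forall fun ω => hw ω)
  have hN : ∫ ω, tiltWeight (fun _ => (1 : ℝ)) (fun _ => (0 : ℂ)) (fun ω => (F ω : ℂ)) (s : ℂ) ω • (F ω : ℂ) ∂ν =
      ((∫ ω, Real.exp (s * F ω) * F ω ∂ν : ℝ) : ℂ) := by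
    rw [← integral_complex_ofReal]
    refine integral_congr_ae (Eventually.of_forall fun ω => ?_)
    show tiltWeight _ _ _ _ ω • (F ω : ℂ) = ((Real.exp (s * F ω) * F ω : ℝ) : ℂ)
    rw [hw ω, smul_eq_mul, Complex.ofReal_mul]
  unfold tiltedMean
  rw [hD, hN, hR, smul_eq_mul, Complex.ofReal_div, div_eq_inv_mul]

end Currencies

/-! ## The dressed weight slice FIRES on the lineage's decided toy (non-vacuity of module `BalabanUVNodesN14DressedWeightSlice`) -/

section DressedToy

/-- On the toy chart of `T4TrajectoryDensity` §8 (`𝒰 = ℂ`, `move U _ t = U + t`, `N ≡ 1`, window `realBall`, `w = ϱ = 1`) the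
observable «the configuration itself» `G U _ := U` satisfies the slice hypothesis of `weightSlice_dressed` with `B = 4` on the open set
`{t | ‖t‖ < 3}` (which contains the closed unit discs about `[0,1]`; there `‖U₀ + t‖ ≤ 1 + 3`). [folklore] -/
theorem toyObservable_alongSlices (μ : Measure ℝ) :
    ∀ U₀ ∈ realBall, ∀ _d : Unit, (0 : ℝ) < 1 → (1 : ℝ) ≤ 1 →
      ∃ Ω' : Set ℂ, IsOpen Ω' ∧ (∀ x ∈ Icc (0 : ℝ) 1, closedBall (x : ℂ) (1 / 1) ⊆ Ω') ∧
        (∀ t ∈ Ω', AEStronglyMeasurable (fun _ : ℝ => U₀ + t) μ) ∧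
        (∀ᵐ _z ∂μ, DifferentiableOn ℂ (fun t : ℂ => U₀ + t) Ω') ∧
        (∀ᵐ _z ∂μ, ∀ t ∈ Ω', ‖U₀ + t‖ ≤ 4) := by
  intro U₀ hU₀ _ _ _
  refine ⟨{t : ℂ | ‖t‖ < 3}, isOpen_lt continuous_norm continuous_const, ?_, fun t _ => aestronglyMeasurable_const,
    Eventually.of_forall fun _ => ((differentiable_id.const_add U₀)).differentiableOn, Eventually.of_forall fun _ t ht => ?_⟩
  · intro x hx y hy
    show ‖y‖ < 3
    have hxy : ‖y - (x : ℂ)‖ ≤ 1 / 1 := by rw [← dist_eq_norm]; exact mem_closedBall.mp hy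
    have hx1 : ‖(x : ℂ)‖ ≤ 1 := by rw [Complex.norm_real, Real.norm_eq_abs, abs_of_nonneg hx.1]; exact hx.2
    calc ‖y‖ = ‖(y - x) + x‖ := by rw [sub_add_cancel]
      _ ≤ ‖y - (x : ℂ)‖ + ‖(x : ℂ)‖ := norm_add_le _ _
      _ < 3 := by linarith
  · have ht3 : ‖t‖ < 3 := ht
    calc ‖U₀ + t‖ ≤ ‖U₀‖ + ‖t‖ := norm_add_le _ _
      _ ≤ 4 := by linarith [hU₀.2]

/-- **THE DRESSED WEIGHT SLICE ON THE DECIDED TOY** [decided instance]: the lineage's toy weight slice `weightSlice_linExp` (margin `s ≥ 0`),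
dressed by `e^{τ·U}` with `‖τ‖ ≤ l₀`, is a weight slice of margin `s + l₀·4` — `weightSlice_dressed` FIRES on an inhabited instance.
[folklore] -/
theorem weightSlice_dressed_toy {s l₀ : ℝ} (hs : 0 ≤ s) {τ : ℂ} (hτ : ‖τ‖ ≤ l₀) :
    WeightSlice (Dir := Unit)
      (fun U z => expWeight (fun _ : ℝ => (1 : ℝ)) (linExp (s / 3)) U z * Complex.exp (τ * U))
      (volume.restrict (Icc (0 : ℝ) 1)) (fun U _ t => U + t) (fun _ => 1) realBall 1 1 (s + l₀ * 4) :=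
  weightSlice_dressed (G := fun (U : ℂ) (_ : ℝ) => U) (weightSlice_linExp hs) hτ
    (toyObservable_alongSlices (volume.restrict (Icc (0 : ℝ) 1)))

/-- … and at `s = 1∕2`, `l₀ = 1∕8` (so `s + l₀·4 = 1 ≤ 1`) the DRESSED normalised operation of the toy is a guarded operator slice with
the constant `e^{3·1}` — `opSliceOn_wOp_dressed` FIRES (the load-bearing smallness met with equality). [folklore] -/
theorem opSliceOn_dressed_toy {τ : ℂ} (hτ : ‖τ‖ ≤ 1 / 8) :
    OpSliceOn (𝒰 := ℂ) (Dir := Unit) (BddClass ℂ (volume.restrict (Icc (0 : ℝ) 1)))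
      (wOp (fun U z => expWeight (fun _ : ℝ => (1 : ℝ)) (linExp ((1 / 2 : ℝ) / 3)) U z * Complex.exp (τ * U))
        (volume.restrict (Icc (0 : ℝ) 1)) 0)
      (Icc (0 : ℝ) 1) (fun U _ t => U + t) (fun _ => 1) realBall 1 1 (Real.exp (3 * ((1 / 2 : ℝ) + 1 / 8 * 4))) :=
  opSliceOn_wOp_dressed (F := ℂ) (G := fun (U : ℂ) (_ : ℝ) => U) 0 (weightSlice_linExp (by norm_num)) hτ
    (toyObservable_alongSlices (volume.restrict (Icc (0 : ℝ) 1))) (by norm_num) (ae_restrict_mem measurableSet_Icc)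

end DressedToy

/-! ## The DRESSED transport leaf on `ℤ^d` BY NAME: END-F's weight-slice pipeline fed by UNDRESSED weight slices + the observable -/

section DressedPipeline

open Literature.MathematicalPhysics.QuantumFieldTheory.Balaban1983to89.T4TermFormat
open Literature.MathematicalPhysics.QuantumFieldTheory.Balaban1983to89.T4TrajectoryComparison
open Literature.MathematicalPhysics.QuantumFieldTheory.Balaban1983to89.T4GatedBooking
open Literature.MathematicalPhysics.QuantumFieldTheory.Balaban1983to89.T4BirthChartTransport (GaugeInvariant BirthSlice RelGauge)
open Literature.MathematicalPhysics.QuantumFieldTheory.Balaban1983to89.T4BlockTransport (Fld NDir latMove latN)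

variable {B : Booking} {T : Trajectory B}
variable {R : Type*} [NormedRing R] [NormedAlgebra ℂ R] [MeasurableSpace R] {d : ℕ}
  {F : Type*} [NormedAddCommGroup F] [NormedSpace ℂ F] [CompleteSpace F]

/-- **THE DRESSED TRANSPORT LEAF, FED BY UNDRESSED WEIGHT SLICES AND THE OBSERVABLE** [bookkeeping]:
`T4TrajectoryDensity.transportsFromVar_of_weightSlices_lattice` VERBATIM (nestings, diameter, births, invariance, defects, attainment)
for the step operation `wOp (ω_k · e^{τ·G_k}) (μ k) (z₀ k)` of the DRESSED run — the observable `G k` attached with source `‖τ‖ ≤ l₀`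
INSIDE the weight — where the weight-slice binder is supplied by the UNDRESSED slices `hws` (margin `s k`) and the observable's slices
`hG` (bound `Bo k`) through `weightSlice_dressed`, at margin `s k + l₀·Bo k ≤ 1` and domination constant `e^{3(s k + l₀ Bo k)}`.
Conclusion: `T.TransportsFromVar (4c_δ∕r) (ψ·α) Gate` — the field `htr` of `DressedRoot.BookingLeaves` for the dressed tower's
trajectory, uniformly in the source window.  (The crew's END-F reads the dressing as a perturbation slice `hP`; this is the
alternative reading «dressing in the weight», margin bookkeeping `s ↦ s + l₀B`.) [folklore] -/
theorem transportsFromVar_dressed_of_weightSlices_lattice {Gate : ℕ → Prop} {Fn : B.Birth → ℕ → ℕ → Fld d R → F}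
    {rel : B.Birth → ℕ → ℕ → Fld d R → Fld d R → Prop} {𝒦 : B.Birth → ℕ → ℕ → Set (Fld d R)}
    {ω : ℕ → Fld d R → Fld d R → ℂ} {G : ℕ → Fld d R → Fld d R → ℂ} {μ : ℕ → Measure (Fld d R)} {z₀ : ℕ → Fld d R}
    {D : ℕ → Set (Fld d R)} {defect : B.Birth → ℕ → ℕ → ℝ} {cδ ψ w r l₀ : ℝ} {τ : ℂ} {s Bo α θ : ℕ → ℝ}
    {ϱ : B.Birth → ℕ → ℕ → ℝ}
    (hα : ∀ i, 0 ≤ α i) (hr : 0 < r) (hw : 0 < w) (hτ : ‖τ‖ ≤ l₀)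
    (hsl : ∀ (b : B.Birth) (k' : ℕ), B.birthScale b ≤ k' → k' ≤ B.K → RanBelow Gate k' →
      BirthSlice (Fn b k' k') latMove latN (𝒦 b k' k') w r (T.gen b k'))
    (hFn : ∀ (b : B.Birth) (k' k : ℕ), B.birthScale b ≤ k' → k' ≤ k → k + 1 ≤ B.K → RanBelow Gate (k + 1) →
      ∀ U, Fn b k' (k + 1) U =
        wOp (fun U z => ω k U z * Complex.exp (τ * G k U z)) (μ k) (z₀ k) U (fun z => Fn b k' k (U + z)))
    (h𝒢 : ∀ (b : B.Birth) (k' k : ℕ), B.birthScale b ≤ k' → k' ≤ k → k + 1 ≤ B.K → RanBelow Gate (k + 1) →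
      ∀ U, (fun z => Fn b k' k (U + z)) ∈ BddClass F (μ k))
    (hD : ∀ k, (D k).Nonempty) (hϱ : ∀ b k' k, 0 < ϱ b k' k)
    (hws : ∀ (b : B.Birth) (k' k : ℕ), B.birthScale b ≤ k' → k' ≤ k → k + 1 ≤ B.K → RanBelow Gate (k + 1) →
      WeightSlice (ω k) (μ k) latMove latN (𝒦 b k' (k + 1)) w (ϱ b k' k) (s k))
    (hG : ∀ (b : B.Birth) (k' k : ℕ), B.birthScale b ≤ k' → k' ≤ k → k + 1 ≤ B.K → RanBelow Gate (k + 1) →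
      ∀ U₀ ∈ 𝒦 b k' (k + 1), ∀ p : NDir d R, 0 < latN p → latN p ≤ w →
        ∃ Ω' : Set ℂ, IsOpen Ω' ∧ (∀ x ∈ Icc (0 : ℝ) 1, closedBall (x : ℂ) (ϱ b k' k / latN p) ⊆ Ω') ∧
          (∀ t ∈ Ω', AEStronglyMeasurable (G k (latMove U₀ p t)) (μ k)) ∧
          (∀ᵐ z ∂μ k, DifferentiableOn ℂ (fun t => G k (latMove U₀ p t) z) Ω') ∧
          (∀ᵐ z ∂μ k, ∀ t ∈ Ω', ‖G k (latMove U₀ p t) z‖ ≤ Bo k))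
    (hs : ∀ k, s k + l₀ * Bo k ≤ 1) (hDμ : ∀ k, ∀ᵐ z ∂μ k, z ∈ D k)
    (hN1 : ∀ (b : B.Birth) (k' k : ℕ), B.birthScale b ≤ k' → k' ≤ k → k + 1 ≤ B.K →
      ∀ z ∈ D k, ∀ U ∈ 𝒦 b k' (k + 1), U + z ∈ 𝒦 b k' k)
    (hN2 : ∀ (b : B.Birth) (k' k : ℕ), B.birthScale b ≤ k' → k' ≤ k → k + 1 ≤ B.K →
      ∀ U₀ ∈ 𝒦 b k' (k + 1), ∀ p : NDir d R, latN p ≤ w → ∀ z' ∈ D k, latMove U₀ p 1 + z' ∈ 𝒦 b k' k)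
    (hdiam : ∀ k, ∀ z ∈ D k, ∀ z' ∈ D k, ∀ x ν, ‖z x ν - z' x ν‖ ≤ θ k)
    (hθ : ∀ k, 0 < θ k ∧ θ k ≤ w)
    (hdom : ∀ (b : B.Birth) (k' k : ℕ), B.birthScale b ≤ k' → k' ≤ k → k + 1 ≤ B.K →
      Real.exp (3 * (s k + l₀ * Bo k)) * (1 + 4 * θ k / ϱ b k' k) ≤ α k)
    (hinv : ∀ b k' k, GaugeInvariant (rel b k' k) (Fn b k' k))
    (hdefw : ∀ b k' k, defect b k' k ≤ w)
    (hrate : ∀ (b : B.Birth) (k' k : ℕ), B.birthScale b ≤ k' → k' ≤ k → k ≤ B.K →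
      defect b k' k ≤ cδ * ψ ^ (k - k'))
    (hlin : ∀ (b : B.Birth) (k' k : ℕ), B.birthScale b ≤ k' → k' ≤ k → k ≤ B.K → RanBelow Gate k → ∀ ε > 0,
      ∃ U₀ ∈ 𝒦 b k' k, ∃ U₁ : Fld d R, RelGauge (rel b k' k) latMove latN U₀ U₁ (defect b k' k) ∧
        T.lin b k' k ≤ ‖Fn b k' k U₁ - Fn b k' k U₀‖ + ε) :
    T.TransportsFromVar (4 * cδ / r) (fun i => ψ * α i) Gate :=
  transportsFromVar_of_weightSlices_lattice (ω := fun k U z => ω k U z * Complex.exp (τ * G k U z))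
    (s := fun k => s k + l₀ * Bo k) hα hr hw hsl hFn h𝒢 hD hϱ
    (fun b k' k hbk' hk'k hk hran => weightSlice_dressed (hws b k' k hbk' hk'k hk hran) hτ (hG b k' k hbk' hk'k hk hran))
    hs hDμ hN1 hN2 hdiam hθ hdom hinv hdefw hrate hlin

end DressedPipeline

/-! ## v1.1 (append-only) — CAUCHY BOUNDS ON ALL SOURCE DERIVATIVES of the tilted normalised operation, uniform in the data -/

section CauchyBounds

variable {Z : Type*} [MeasurableSpace Z] {μ : Measure Z} {F : Type*} [NormedAddCommGroup F] [NormedSpace ℂ F] [CompleteSpace F]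
variable {ρ₀ : Z → ℝ} {σ W : Z → ℂ} {h : Z → F} {s B m : ℝ}

/-- A closed source ball of radius `R` about `t` with `s + (‖t‖ + R)·B ≤ 1` lies in the closed tilt disc: every `z` in it has
`s + ‖z‖·B ≤ 1` (for `0 ≤ B`). [folklore] -/
theorem tilt_le_one_of_mem_closedBall {t z : ℂ} {R : ℝ} (hB : 0 ≤ B) (hR : s + (‖t‖ + R) * B ≤ 1)
    (hz : z ∈ closedBall t R) : s + ‖z‖ * B ≤ 1 := by
  have hz' : ‖z‖ ≤ ‖t‖ + R := by
    have h1 : ‖z - t‖ ≤ R := by rw [← dist_eq_norm]; exact mem_closedBall.mp hz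
    have h2 : ‖z‖ - ‖t‖ ≤ ‖z - t‖ := norm_sub_norm_le z t
    linarith
  have := mul_le_mul_of_nonneg_right hz' hB
  linarith

/-- **CAUCHY BOUNDS ON ALL SOURCE DERIVATIVES** [folklore]: for `0 < R` with `s + (‖t‖ + R)·B < 1` (the closed ball of radius `R`
about `t` inside the open tilt disc), `0 ≤ m`, and `‖σ‖ ≤ s`, `‖W‖ ≤ B`, `‖h‖ ≤ m` a.e. over a nonnegative integrable density of positive
mass: `‖∂ⁿ_t E_t h‖ ≤ n! · e^{3(s + (‖t‖+R)B)} · m ∕ Rⁿ` for EVERY `n` — Mathlib's Cauchy estimate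
`Complex.norm_iteratedDeriv_le_of_forall_mem_sphere_norm_le` on the circle of radius `R`, where (1.75)ₜ (`norm_tiltedMean_le`, p409237)
bounds the operation by `e^{3(s+‖z‖B)}·m ≤ e^{3(s+(‖t‖+R)B)}·m`.  The constants depend on `(s, B, m, R)` ONLY — the «t-analytic with
uniform constants» clause of NE1′ at the level of one complex-weight integral. -/
theorem norm_iteratedDeriv_tiltedMean_le (hρ : Integrable ρ₀ μ) (hρ0 : 0 ≤ᵐ[μ] ρ₀) (hP : 0 < ∫ z, ρ₀ z ∂μ)
    (hσm : AEStronglyMeasurable σ μ) (hWm : AEStronglyMeasurable W μ) (hσ : ∀ᵐ z ∂μ, ‖σ z‖ ≤ s)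
    (hW : ∀ᵐ z ∂μ, ‖W z‖ ≤ B) (hhm : AEStronglyMeasurable h μ) (hh : ∀ᵐ z ∂μ, ‖h z‖ ≤ m) (hm : 0 ≤ m)
    {t : ℂ} {R : ℝ} (hR : 0 < R) (htR : s + (‖t‖ + R) * B < 1) (n : ℕ) :
    ‖iteratedDeriv n (fun τ : ℂ => tiltedMean μ ρ₀ σ W h τ) t‖ ≤
      n.factorial * (Real.exp (3 * (s + (‖t‖ + R) * B)) * m) / R ^ n := by
  have hB0 : 0 ≤ B := by
    have hμ : μ ≠ 0 := by
      intro h0; rw [h0, integral_zero_measure] at hP; exact lt_irrefl _ hP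
    haveI : (ae μ).NeBot := ae_neBot.mpr hμ
    obtain ⟨z, hz⟩ := hW.exists
    exact (norm_nonneg _).trans hz
  -- the closed ball lies inside the open tilt disc, where the operation is complex-differentiable
  have hsub : closedBall t R ⊆ {τ : ℂ | s + ‖τ‖ * B < 1} := by
    intro z hz
    show s + ‖z‖ * B < 1
    have hz' : ‖z‖ ≤ ‖t‖ + R := by
      have h1 : ‖z - t‖ ≤ R := by rw [← dist_eq_norm]; exact mem_closedBall.mp hz
      have h2 : ‖z‖ - ‖t‖ ≤ ‖z - t‖ := norm_sub_norm_le z t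
      linarith
    have := mul_le_mul_of_nonneg_right hz' hB0
    linarith
  have hdiff : DifferentiableOn ℂ (fun τ : ℂ => tiltedMean μ ρ₀ σ W h τ) (closedBall t R) :=
    (differentiableOn_tiltedMean hρ hρ0 hP hσm hWm hσ hW hhm hh).mono hsub
  have hdc : DiffContOnCl ℂ (fun τ : ℂ => tiltedMean μ ρ₀ σ W h τ) (ball t R) :=
    DiffContOnCl.mk (hdiff.mono ball_subset_closedBall) (by rw [closure_ball t hR.ne']; exact hdiff.continuousOn)
  refine Complex.norm_iteratedDeriv_le_of_forall_mem_sphere_norm_le n hR hdc fun z hz => ?_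
  have hz1 : s + ‖z‖ * B ≤ 1 := tilt_le_one_of_mem_closedBall hB0 htR.le (sphere_subset_closedBall hz)
  have hzR : ‖z‖ ≤ ‖t‖ + R := by
    have h1 : ‖z - t‖ = R := by rw [← dist_eq_norm]; exact mem_sphere.mp hz
    have h2 : ‖z‖ - ‖t‖ ≤ ‖z - t‖ := norm_sub_norm_le z t
    linarith
  calc ‖tiltedMean μ ρ₀ σ W h z‖ ≤ Real.exp (3 * (s + ‖z‖ * B)) * m :=
        norm_tiltedMean_le hρ hρ0 hP hσm hWm hσ hW hh hm hz1
    _ ≤ Real.exp (3 * (s + (‖t‖ + R) * B)) * m := by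
        have : s + ‖z‖ * B ≤ s + (‖t‖ + R) * B := by
          have := mul_le_mul_of_nonneg_right hzR hB0; linarith
        gcongr

end CauchyBounds

end

end YMDAG.N14
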